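import Literature.Algebra.Homology.OrderedCechKoszulKernels
import Mathlib.RingTheory.MvPolynomial.EulerIdentity
import HarnessLib

/-!
# The Koszul complex of the variables is exact in non-zero total degree (Euler homotopy)

Görtz–Wedhorn, *Algebraic Geometry II*, Thm. 19.12 (i) ⇒ (ii): a (weakly) regular sequence is
completely intersecting, i.e. its Koszul complex is exact in positive degrees; the basic example is
the sequence of variables `x = (x_i)_{i ∈ ι}` of a polynomial ring `S = A[x_i]`. This file proves
that exactness for the variables in the graded form used by the Čech computations on `ℙ^r`
(`OrderedCechKoszulKernels`: the Koszul differential `KoszulCech.kd x q : C_{q+1} → C_q` on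
`q`-cochains `Sub ι q → S`, `S = A[x_i]`), by the EULER HOMOTOPY (Cartan's formula `L_E = ι_E d + d ι_E` for the
Euler field `E = Σ x_i ∂_i`, read with `ι_E` = the Koszul differential and `d` = the de Rham-type
operator `κ = Σ_i e_i ∧ ∂/∂x_i`):

* `KoszulCech.pderivCochain i q` (`∂/∂x_i` coordinatewise on `q`-cochains), `KoszulCech.eulerHomotopy q`
  (`κ = Σ_i e_i ∧ ∂/∂x_i : C_q → C_{q+1}`, `e_i ∧ · = kh 1 i`);
* `KoszulCech.pderiv_kd` — `∂/∂x_i ∘ ∂_x = ∂_x ∘ ∂/∂x_i + ∂_{e_i}` (Leibniz; `∂_{e_i}` the Koszul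
  differential of the `i`-th unit vector sequence);
* `KoszulCech.sum_kh_kd_single` — `Σ_i e_i ∧ ∂_{e_i} = (q+1) · id` on `(q+1)`-cochains;
* **`KoszulCech.kd_euler_add_euler_kd`** — for a `(q+1)`-cochain `v` with homogeneous coordinates
  of degree `m`: `∂ (κ v) + κ (∂ v) = (m + q + 1) · v` (Mathlib's Euler identity
  `MvPolynomial.IsHomogeneous.sum_X_mul_pderiv` plus the cone identity
  `KoszulCech.kd_kh_add_kh_kd` of the engine); `kd_euler_zero` is the degree-`0` form;
* **`KoszulCech.exists_kd_eq_of_kd_eq_zero`** — hence a Koszul CYCLE with homogeneous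
  coordinates of degree `m` in cochain degree `q + 1` is a BOUNDARY, `v = ∂ w` with `w`
  homogeneous of degree `m - 1`, as soon as `m + q + 1` is invertible in `A` (always over a
  `ℚ`-algebra, `exists_kd_eq_of_kd_eq_zero_of_algebraRat`); in cochain degree `0` every
  homogeneous `v` of degree `m` invertible in `A` is a boundary (`exists_kd_eq_zero_level`);
* `KoszulCech.eq_zero_of_kd_eq_zero_of_isHomogeneous_zero` — a cycle with CONSTANT coordinates in
  cochain degree `q + 1` vanishes when `q + 1` is invertible.

In the grading of `GAGADifferentialFormsProjectiveSpace` (`Z_p ⊆ Λ^p P^{r+1}(-p)`, internal degree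
`k` = coefficient degree `+ p`) this says `(Z_p)_k = ∂((Λ^{p+1})_k)` for every `k ≠ 0`: the Koszul
complex of `(x_0, …, x_r)` on `ℂ[x_0, …, x_r]` is exact except in total degree `0`, where it is
`Λ^0 = ℂ`. Two definitions with bodies (`pderivCochain`, `eulerHomotopy`) and theorems; no named
facts.
TODO(general form): over an arbitrary commutative ring (no divisibility) via regular sequences,
Görtz–Wedhorn Thm. 19.12.

## References
* [GortzWedhorn2023] U. Görtz, T. Wedhorn, *Algebraic Geometry II* (2023), (19.1)–(19.2),
  Def. 19.10, Thm. 19.12 (p. 119).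
* [Weibel1994] C. A. Weibel, *An Introduction to Homological Algebra* (1994), Cor. 4.5.5.
-/

noncomputable section

open MvPolynomial Finset

universe u

namespace Literature.Algebra.Homology

namespace KoszulCech

open OrderedCech

variable {ι : Type} [LinearOrder ι] [Fintype ι] {A : Type u} [CommRing A]

/-! ### The two operators -/

omit [LinearOrder ι] [Fintype ι] in
/-- **Coordinatewise partial derivative** `∂/∂x_i` on `q`-cochains `Sub ι q → A[x]`, `A`-linearly.
[cite: GortzWedhorn2023, (19.1)] -/
def pderivCochain (i : ι) (q : ℕ) :
    (Sub ι q → MvPolynomial ι A) →ₗ[A] (Sub ι q → MvPolynomial ι A) :=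
  LinearMap.compLeft (Derivation.toLinearMap
    (MvPolynomial.pderiv i : Derivation A (MvPolynomial ι A) (MvPolynomial ι A))) (Sub ι q)

/-- **The Euler homotopy** `κ = Σ_i e_i ∧ ∂/∂x_i : C_q → C_{q+1}` (`e_i ∧ ·` is the cone `kh 1 i`
of `OrderedCechKoszulKernels`). [cite: GortzWedhorn2023, (19.1) and Thm. 19.12] -/
def eulerHomotopy (q : ℕ) :
    (Sub ι q → MvPolynomial ι A) →ₗ[A] (Sub ι (q + 1) → MvPolynomial ι A) :=
  ∑ i : ι, (kh (1 : MvPolynomial ι A) i q).restrictScalars A ∘ₗ pderivCochain i q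

/-- Unfolding `eulerHomotopy`. [cite: GortzWedhorn2023, (19.1)] -/
theorem eulerHomotopy_apply (q : ℕ) (v : Sub ι q → MvPolynomial ι A) :
    eulerHomotopy q v = ∑ i : ι, kh (1 : MvPolynomial ι A) i q (pderivCochain i q v) := by
  rw [eulerHomotopy, LinearMap.sum_apply]; rfl

/-! ### Derivations and the signs -/

omit [Fintype ι] in
/-- A derivation kills the signs `ε(s, a) = ±1`. [folklore] -/
private theorem pderiv_sign (i : ι) (s : Finset ι) (a : ι) :
    pderiv i (sign (MvPolynomial ι A) s a) = 0 := by
  unfold sign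
  rcases neg_one_pow_eq_or (MvPolynomial ι A) (s.filter (· < a)).card with h | h
  · rw [h]; exact pderiv_one
  · rw [h, map_neg, pderiv_one, neg_zero]

omit [LinearOrder ι] [Fintype ι] in
/-- `extL` commutes with the coordinatewise derivative. [folklore] -/
private theorem extL_D (i : ι) (q : ℕ) (K : Finset ι) (v : Sub ι q → MvPolynomial ι A) :
    extL (MvPolynomial ι A) q K (pderivCochain i q v) = pderiv i (extL (MvPolynomial ι A) q K v) := by
  by_cases h : K.card = q
  · rw [extL_apply_of_eq h, extL_apply_of_eq h]; rfl
  · rw [extL_apply_of_ne h, extL_apply_of_ne h, map_zero]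

omit [LinearOrder ι] [Fintype ι] in
/-- The coordinates of `D_i v`. [folklore] -/
private theorem D_apply (i : ι) (q : ℕ) (v : Sub ι q → MvPolynomial ι A) (K : Sub ι q) :
    (pderivCochain i q v) K = pderiv i (v K) := rfl

/-! ### Leibniz: `∂/∂x_i ∘ ∂ = ∂ ∘ ∂/∂x_i + ∂_{e_i}` -/

/-- **`∂/∂x_i (∂ v) = ∂ (∂/∂x_i v) + ∂_{e_i} v`**, where `∂_{e_i} = kd (Pi.single i 1)` is the
Koszul differential of the `i`-th unit vector sequence (contraction with `e_i`): the Leibniz rule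
`∂/∂x_i (x_j f) = δ_{ij} f + x_j ∂f/∂x_i`. [cite: GortzWedhorn2023, (19.1)] -/
theorem pderiv_kd (i : ι) (q : ℕ) (v : Sub ι (q + 1) → MvPolynomial ι A) :
    pderivCochain i q (kd (fun i : ι => (X i : MvPolynomial ι A)) q v) = kd (fun i : ι => (X i : MvPolynomial ι A)) q (pderivCochain i (q + 1) v) + kd (Pi.single i (1 : MvPolynomial ι A)) q v := by
  classical
  funext I
  rw [Pi.add_apply, D_apply, kd_apply, kd_apply, kd_apply, map_sum]
  rw [← Finset.sum_add_distrib]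
  refine Finset.sum_congr rfl fun j _ => ?_
  rw [smul_eq_mul, smul_eq_mul, smul_eq_mul, extL_D, Derivation.leibniz, Derivation.leibniz,
    pderiv_sign, pderiv_X, smul_eq_mul, smul_eq_mul, smul_eq_mul]
  by_cases hij : j = i
  · subst hij
    rw [Pi.single_eq_same]
    ring
  · rw [Pi.single_eq_of_ne hij]
    ring

/-! ### `Σ_i e_i ∧ ∂_{e_i} = (q+1) · id` -/

/-- **`Σ_i e_i ∧ (∂_{e_i} v) = (q + 1) · v`** on `(q+1)`-cochains: for `i ∈ K` the `i`-th term
returns `ε(K,i)² v_K = v_K`, for `i ∉ K` it vanishes. [cite: GortzWedhorn2023, (19.1)] -/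
theorem sum_kh_kd_single (q : ℕ) (v : Sub ι (q + 1) → MvPolynomial ι A) :
    ∑ i : ι, kh (1 : MvPolynomial ι A) i q (kd (Pi.single i (1 : MvPolynomial ι A)) q v) = (q + 1) • v := by
  classical
  funext K
  rw [Finset.sum_apply, Pi.smul_apply]
  obtain ⟨K, hK⟩ := K
  have hterm : ∀ i, kh (1 : MvPolynomial ι A) i q (kd (Pi.single i (1 : MvPolynomial ι A)) q v) ⟨K, hK⟩ =
      if i ∈ K then v ⟨K, hK⟩ else 0 := by
    intro i
    rw [kh_apply]
    dsimp only
    split_ifs with hi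
    · have hcard : (K.erase i).card = q := by rw [Finset.card_erase_of_mem hi, hK]; rfl
      rw [extL_kd _ q v hcard, Finset.sum_eq_single i]
      · rw [Pi.single_eq_same, mul_one, Finset.insert_erase hi, extL_apply_of_eq hK, smul_smul,
          mul_one, sign_mul_sign_self, one_smul]
      · intro j _ hji
        rw [Pi.single_eq_of_ne hji, mul_zero, zero_smul]
      · intro h; exact absurd (Finset.mem_univ i) h
    · rw [Finset.erase_eq_of_notMem hi, extL_apply_of_ne (by rw [hK]; omega), smul_zero]
  simp_rw [hterm]
  rw [Finset.sum_ite_mem, Finset.univ_inter, Finset.sum_const, hK]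

/-! ### The Euler homotopy identity -/

omit [LinearOrder ι] in
/-- **Euler's identity coordinatewise**: `Σ_i x_i · ∂v/∂x_i = m · v` for a cochain with homogeneous
coordinates of degree `m` (Mathlib `MvPolynomial.IsHomogeneous.sum_X_mul_pderiv`). [folklore] -/
private theorem sum_X_smul_D {q m : ℕ} {v : Sub ι q → MvPolynomial ι A} (hv : ∀ K, (v K).IsHomogeneous m) :
    ∑ i : ι, (X i : MvPolynomial ι A) • pderivCochain i q v = m • v := by
  funext K
  rw [Finset.sum_apply, Pi.smul_apply]
  simp_rw [Pi.smul_apply, D_apply, smul_eq_mul]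
  exact (hv K).sum_X_mul_pderiv

/-- **The Euler homotopy identity `∂ κ + κ ∂ = (m + q + 1) · id`** on `(q+1)`-cochains with
homogeneous coordinates of degree `m`, `κ = Σ_i e_i ∧ ∂/∂x_i` (Cartan's formula for the Euler
vector field: `Σ_i [∂ (e_i ∧ ·) + (e_i ∧ ·) ∂] ∂/∂x_i = Σ_i x_i ∂/∂x_i` by the cone identity
`kd_kh_add_kh_kd`, plus `Σ_i e_i ∧ ∂_{e_i} = (q+1)` from the Leibniz correction `pderiv_kd`).
[cite: GortzWedhorn2023, Thm. 19.12] -/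
theorem kd_euler_add_euler_kd (q : ℕ) {m : ℕ} (v : Sub ι (q + 1) → MvPolynomial ι A)
    (hv : ∀ K, (v K).IsHomogeneous m) :
    kd (fun i : ι => (X i : MvPolynomial ι A)) (q + 1) (eulerHomotopy (q + 1) v) + eulerHomotopy q (kd (fun i : ι => (X i : MvPolynomial ι A)) q v) = (m + (q + 1)) • v := by
  rw [eulerHomotopy_apply, eulerHomotopy_apply, map_sum]
  have h1 : ∀ i, kh (1 : MvPolynomial ι A) i q (pderivCochain i q (kd (fun i : ι => (X i : MvPolynomial ι A)) q v)) =
      kh (1 : MvPolynomial ι A) i q (kd (fun i : ι => (X i : MvPolynomial ι A)) q (pderivCochain i (q + 1) v)) + kh (1 : MvPolynomial ι A) i q (kd (Pi.single i (1 : MvPolynomial ι A)) q v) := by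
    intro i; rw [pderiv_kd, map_add]
  simp_rw [h1]
  rw [Finset.sum_add_distrib, ← add_assoc, ← Finset.sum_add_distrib]
  have h2 : ∀ i, kd (fun i : ι => (X i : MvPolynomial ι A)) (q + 1) (kh (1 : MvPolynomial ι A) i (q + 1) (pderivCochain i (q + 1) v)) +
      kh (1 : MvPolynomial ι A) i q (kd (fun i : ι => (X i : MvPolynomial ι A)) q (pderivCochain i (q + 1) v)) = (X i : MvPolynomial ι A) • pderivCochain i (q + 1) v := by
    intro i
    rw [kd_kh_add_kh_kd, one_mul]
  simp_rw [h2]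
  rw [sum_X_smul_D hv, sum_kh_kd_single, ← add_smul]

/-- **The Euler identity in cochain degree `0`**: `∂ (κ v) = m · v` for a `0`-cochain with
homogeneous coordinate of degree `m`. [cite: GortzWedhorn2023, Thm. 19.12] -/
theorem kd_euler_zero {m : ℕ} (v : Sub ι 0 → MvPolynomial ι A) (hv : ∀ K, (v K).IsHomogeneous m) :
    kd (fun i : ι => (X i : MvPolynomial ι A)) 0 (eulerHomotopy 0 v) = m • v := by
  rw [eulerHomotopy_apply, map_sum]
  have h2 : ∀ i, kd (fun i : ι => (X i : MvPolynomial ι A)) 0 (kh (1 : MvPolynomial ι A) i 0 (pderivCochain i 0 v)) = (X i : MvPolynomial ι A) • pderivCochain i 0 v := by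
    intro i
    rw [kd_kh_zero, one_mul]
  simp_rw [h2]
  exact sum_X_smul_D hv

/-! ### Exactness in non-zero total degree -/

/-- The Euler homotopy lowers the coefficient degree by one. [folklore] -/
private theorem isHomogeneous_euler (q : ℕ) {m : ℕ} (v : Sub ι q → MvPolynomial ι A)
    (hv : ∀ K, (v K).IsHomogeneous m) (K : Sub ι (q + 1)) :
    ((eulerHomotopy q v) K).IsHomogeneous (m - 1) := by
  rw [eulerHomotopy_apply, Finset.sum_apply]
  refine IsHomogeneous.sum _ _ _ fun i _ => ?_
  rw [kh_apply, mul_one, smul_eq_mul]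
  by_cases h : (K.1.erase i).card = q
  · rw [extL_apply_of_eq h, D_apply]
    have hs : (sign (MvPolynomial ι A) K.1 i).IsHomogeneous 0 := by
      unfold sign
      rcases neg_one_pow_eq_or (MvPolynomial ι A) (K.1.filter (· < i)).card with h' | h'
      · rw [h']; exact isHomogeneous_one ι A
      · rw [h']; exact (isHomogeneous_one ι A).neg
    simpa using hs.mul (hv _).pderiv
  · rw [extL_apply_of_ne h, mul_zero]
    exact isHomogeneous_zero ι A _

/-- **The Koszul complex of the variables is exact in non-zero total degree**: a `(q+1)`-cochain
`v` with homogeneous coordinates of degree `m` and `∂ v = 0` is a boundary, `v = ∂ w` with `w`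
homogeneous of degree `m - 1`, provided the total degree `m + q + 1` is invertible in `A`
(`w = (m+q+1)⁻¹ κ v` by `kd_euler_add_euler_kd`). [cite: GortzWedhorn2023, Thm. 19.12 (i) ⇒ (ii)] -/
theorem exists_kd_eq_of_kd_eq_zero (q : ℕ) {m : ℕ} (v : Sub ι (q + 1) → MvPolynomial ι A)
    (hv : ∀ K, (v K).IsHomogeneous m) (hz : kd (fun i : ι => (X i : MvPolynomial ι A)) q v = 0) (hu : IsUnit ((m + (q + 1) : ℕ) : A)) :
    ∃ w : Sub ι (q + 2) → MvPolynomial ι A, (∀ K, (w K).IsHomogeneous (m - 1)) ∧ kd (fun i : ι => (X i : MvPolynomial ι A)) (q + 1) w = v := by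
  obtain ⟨c, hc⟩ := hu
  have key := kd_euler_add_euler_kd q v hv
  rw [hz, map_zero, add_zero] at key
  refine ⟨(C (↑c⁻¹ : A) : MvPolynomial ι A) • eulerHomotopy (q + 1) v, fun K => ?_, ?_⟩
  · rw [Pi.smul_apply, smul_eq_mul]
    simpa using (isHomogeneous_C ι (↑c⁻¹ : A)).mul (isHomogeneous_euler (q + 1) v hv K)
  · have h2 : (C (↑c⁻¹ : A) : MvPolynomial ι A) * ((m + (q + 1) : ℕ) : MvPolynomial ι A) = 1 := by
      rw [← map_natCast C, ← map_mul, ← hc, Units.inv_mul, map_one]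
    rw [LinearMap.map_smul, key, ← Nat.cast_smul_eq_nsmul (MvPolynomial ι A) (m + (q + 1)) v, smul_smul, h2,
      one_smul]

/-- **Exactness in cochain degree `0`**: a `0`-cochain with homogeneous coordinate of degree `m`
invertible in `A` is a boundary. [cite: GortzWedhorn2023, Thm. 19.12 (i) ⇒ (ii)] -/
theorem exists_kd_eq_zero_level {m : ℕ} (v : Sub ι 0 → MvPolynomial ι A) (hv : ∀ K, (v K).IsHomogeneous m)
    (hu : IsUnit ((m : ℕ) : A)) :
    ∃ w : Sub ι 1 → MvPolynomial ι A, (∀ K, (w K).IsHomogeneous (m - 1)) ∧ kd (fun i : ι => (X i : MvPolynomial ι A)) 0 w = v := by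
  obtain ⟨c, hc⟩ := hu
  have key := kd_euler_zero v hv
  refine ⟨(C (↑c⁻¹ : A) : MvPolynomial ι A) • eulerHomotopy 0 v, fun K => ?_, ?_⟩
  · rw [Pi.smul_apply, smul_eq_mul]
    simpa using (isHomogeneous_C ι (↑c⁻¹ : A)).mul (isHomogeneous_euler 0 v hv K)
  · have h2 : (C (↑c⁻¹ : A) : MvPolynomial ι A) * ((m : ℕ) : MvPolynomial ι A) = 1 := by
      rw [← map_natCast C, ← map_mul, ← hc, Units.inv_mul, map_one]
    rw [LinearMap.map_smul, key, ← Nat.cast_smul_eq_nsmul (MvPolynomial ι A) m v, smul_smul, h2, one_smul]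

/-- Over a `ℚ`-algebra every non-zero total degree is invertible: a Koszul cycle with homogeneous
coordinates of degree `m` in cochain degree `q + 1` is a boundary.
[cite: GortzWedhorn2023, Thm. 19.12 (i) ⇒ (ii)] -/
theorem exists_kd_eq_of_kd_eq_zero_of_algebraRat [Algebra ℚ A] (q : ℕ) {m : ℕ}
    (v : Sub ι (q + 1) → MvPolynomial ι A) (hv : ∀ K, (v K).IsHomogeneous m) (hz : kd (fun i : ι => (X i : MvPolynomial ι A)) q v = 0) :
    ∃ w : Sub ι (q + 2) → MvPolynomial ι A, (∀ K, (w K).IsHomogeneous (m - 1)) ∧ kd (fun i : ι => (X i : MvPolynomial ι A)) (q + 1) w = v :=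
  exists_kd_eq_of_kd_eq_zero q v hv hz (by
    rw [← map_natCast (algebraMap ℚ A)]
    exact (IsUnit.mk0 _ (by positivity)).map _)

/-- **A Koszul cycle with constant coordinates in cochain degree `q + 1` vanishes** when `q + 1`
is invertible in `A` (`(q+1) v = ∂ κ v + κ ∂ v = 0` since `κ` differentiates constants to `0`).
[cite: GortzWedhorn2023, Thm. 19.12 (i) ⇒ (ii)] -/
theorem eq_zero_of_kd_eq_zero_of_isHomogeneous_zero (q : ℕ) (v : Sub ι (q + 1) → MvPolynomial ι A)
    (hv : ∀ K, (v K).IsHomogeneous 0) (hz : kd (fun i : ι => (X i : MvPolynomial ι A)) q v = 0) (hu : IsUnit (((q + 1 : ℕ)) : A)) :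
    v = 0 := by
  have key := kd_euler_add_euler_kd q v hv
  rw [hz, map_zero, add_zero, zero_add] at key
  -- `κ v = 0`: the derivative of a constant vanishes
  have hκ : eulerHomotopy (q + 1) v = 0 := by
    rw [eulerHomotopy_apply]
    refine Finset.sum_eq_zero fun i _ => ?_
    have : pderivCochain i (q + 1) v = 0 := by
      funext K
      rw [D_apply, Pi.zero_apply]
      have h0 := hv K
      rw [← totalDegree_zero_iff_isHomogeneous, totalDegree_eq_zero_iff_eq_C] at h0
      rw [h0, pderiv_C]
    rw [this, map_zero]
  rw [hκ, map_zero] at key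
  -- `(q+1) • v = 0` with `q + 1` invertible
  obtain ⟨c, hc⟩ := hu
  have h1 : ((q + 1 : ℕ) : MvPolynomial ι A) • v = 0 := by rw [Nat.cast_smul_eq_nsmul]; exact key.symm
  have h2 : (C (↑c⁻¹ : A) : MvPolynomial ι A) * ((q + 1 : ℕ) : MvPolynomial ι A) = 1 := by
    rw [← map_natCast C, ← map_mul, ← hc, Units.inv_mul, map_one]
  calc v = ((C (↑c⁻¹ : A) : MvPolynomial ι A) * ((q + 1 : ℕ) : MvPolynomial ι A)) • v := by rw [h2, one_smul]
    _ = 0 := by rw [← smul_smul, h1, smul_zero]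

end KoszulCech

end Literature.Algebra.Homology

end
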